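import Summits.ValiantsHypothesis.ValiantsHypothesis.Theorems.BarrierLeverChowThinRowsSingletonDesignEntries
import Summits.ValiantsHypothesis.ValiantsHypothesis.Theorems.BarrierLeverChowThinRowsPureFactorDoubling

/-!
# Route BarrierLever — item `ChowHitsThinRowPartitionMinors` (stmt-ValiantsHypothesis-20195):
# rows of the singleton design with DOUBLED pure factors, in closed form (prelims for Hamming-ball columns)

Helper file (`--supports stmt-ValiantsHypothesis-20195`; cell valiant-natproofs, rung V4, 𝒟-side of
door (c); prover seat val-np-p8 gen 2).  Closes NO item; imports `…ChowThinRowsSingletonDesignEntries` and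
`…ChowThinRowsPureFactorDoubling` (val-np-p8 g2); no route file, no definitions.

For the singleton indicator design `∏_{V ∈ 𝒦} φ_V` (`𝒦` = sets of size `≤ 1` containing every singleton)
multiplied by the doubled pure factors `∏_{c ∈ D} (1 + y_c)`, the thin rows at an arbitrary column `W`
are, with `T = W ∩ D`, `A_a = Σ_V κ_a(V)`, `κ_a(X) = Σ_{c∈X} κ_a({c})`, `α = A_a − κ_a(W)`, `β = A_b − κ_b(W)`,
`Q = Σ_V κ_a(V)κ_b(V)`, `H(X) = Σ_{c∈X} κ_a({c})κ_b({c})`: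
* `dbl_entry_empty`  — row `∅`: `2^{|T|}`;
* `dbl_entry_single` — row `{a}`: `2 · entry = 2^{|T|} · (2α + κ_a(T))`;
* `dbl_entry_pair`   — row `{a,b}`: `4 · entry = 2^{|T|} · (4αβ − 4Q + 4H(W) + 2ακ_b(T) + 2βκ_a(T) + κ_a(T)κ_b(T) − H(T))`.
(On a Hamming ball around `p` with `D` = the inward directions and `2A_a = κ_a(D)` these become
`0 / 2^{m-1}κ_a(c) / −2^{m+1}κ_a(c)` and `2^t (c_ab + ρ κ_a(c)κ_b(c))`, `ρ ∈ {0, −2, 8}`: MEMO-pairlayer-g2 §1c.)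

WHAT THIS IS NOT: bookkeeping only; nothing on items 20195 / 20172 / 19717 themselves, on crux
stmt-ValiantsHypothesis-14610, or on `VP` versus `VNP`.
-/

set_option linter.dupNamespace false

namespace Summit.ValiantsHypothesis.ValiantsHypothesis.Theorems.BarrierLever.ChowSubcube

open Finset MvPolynomial

variable {h : ℕ}

/-- Row `∅` of the doubled design at column `W`: `2^{|W ∩ D|}`. -/
theorem dbl_entry_empty (κ : Fin h → Finset (Fin h) → ℂ) (𝒦 : Finset (Finset (Fin h)))
    (h1 : ∀ V ∈ 𝒦, V.card ≤ 1) (hsing : ∀ c : Fin h, ({c} : Finset (Fin h)) ∈ 𝒦) (D W : Finset (Fin h)) :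
    coeff (∑ a ∈ (∅ : Finset (Fin h)), Finsupp.single (Fin.castAdd h a) 1 +
        ∑ c ∈ W, Finsupp.single (Fin.natAdd h c) 1)
        ((∏ V ∈ 𝒦, (C 1 + ∑ a, C (κ a V) * X (Fin.castAdd h a) +
          ∑ c, C (if c ∈ V then (1 : ℂ) else 0) * X (Fin.natAdd h c))) *
          ∏ c ∈ D, (C 1 + X (Fin.natAdd h c))) = 2 ^ (W ∩ D).card := by
  classical
  rw [coeff_mul_prod_pureY, Finset.sum_congr rfl fun S _ => coeff_empty_prod_card_le_one κ 𝒦 h1 (W \ S)]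
  rw [Finset.sum_congr rfl fun S _ => if_pos fun c _ => hsing c, Finset.sum_const, Finset.card_powerset]
  simp

/-- Row `{a}` of the doubled design at column `W` (times `2`): `2^{|T|} · (2(A_a − κ_a(W)) + κ_a(T))`,
`T = W ∩ D`. -/
theorem dbl_entry_single (κ : Fin h → Finset (Fin h) → ℂ) (𝒦 : Finset (Finset (Fin h)))
    (h1 : ∀ V ∈ 𝒦, V.card ≤ 1) (hsing : ∀ c : Fin h, ({c} : Finset (Fin h)) ∈ 𝒦) (D W : Finset (Fin h))
    (a : Fin h) :
    2 * coeff (∑ a' ∈ ({a} : Finset (Fin h)), Finsupp.single (Fin.castAdd h a') 1 +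
        ∑ c ∈ W, Finsupp.single (Fin.natAdd h c) 1)
        ((∏ V ∈ 𝒦, (C 1 + ∑ a, C (κ a V) * X (Fin.castAdd h a) +
          ∑ c, C (if c ∈ V then (1 : ℂ) else 0) * X (Fin.natAdd h c))) *
          ∏ c ∈ D, (C 1 + X (Fin.natAdd h c))) =
      2 ^ (W ∩ D).card * (2 * (∑ V ∈ 𝒦, κ a V - ∑ c ∈ W, κ a {c}) + ∑ c ∈ W ∩ D, κ a {c}) := by
  classical
  rw [coeff_mul_prod_pureY]
  have hterm : ∀ S ∈ (W ∩ D).powerset,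
      coeff (∑ a' ∈ ({a} : Finset (Fin h)), Finsupp.single (Fin.castAdd h a') 1 +
          ∑ c ∈ W \ S, Finsupp.single (Fin.natAdd h c) 1)
        (∏ V ∈ 𝒦, (C 1 + ∑ a, C (κ a V) * X (Fin.castAdd h a) +
          ∑ c, C (if c ∈ V then (1 : ℂ) else 0) * X (Fin.natAdd h c))) =
      (∑ V ∈ 𝒦, κ a V - ∑ c ∈ W, κ a {c}) + ∑ c ∈ S, κ a {c} := by
    intro S hS
    have hSW : S ⊆ W := (Finset.mem_powerset.mp hS).trans Finset.inter_subset_left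
    rw [coeff_single_prod_card_le_one κ 𝒦 h1 a (W \ S) (fun c _ => hsing c),
      ← Finset.sum_sdiff hSW]
    ring
  rw [Finset.sum_congr rfl hterm, Finset.sum_add_distrib, Finset.sum_const, Finset.card_powerset,
    nsmul_eq_mul, mul_add, two_mul_sum_powerset_sum]
  push_cast
  ring

/-- Row `{a,b}` (`a ≠ b`) of the doubled design at column `W` (times `4`), `T = W ∩ D`:
`2^{|T|} · (4αβ − 4Q + 4H(W) + 2ακ_b(T) + 2βκ_a(T) + κ_a(T)κ_b(T) − H(T))`. -/
theorem dbl_entry_pair (κ : Fin h → Finset (Fin h) → ℂ) (𝒦 : Finset (Finset (Fin h)))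
    (h1 : ∀ V ∈ 𝒦, V.card ≤ 1) (hsing : ∀ c : Fin h, ({c} : Finset (Fin h)) ∈ 𝒦) (D W : Finset (Fin h))
    {a b : Fin h} (hab : a ≠ b) :
    4 * coeff (∑ a' ∈ ({a, b} : Finset (Fin h)), Finsupp.single (Fin.castAdd h a') 1 +
        ∑ c ∈ W, Finsupp.single (Fin.natAdd h c) 1)
        ((∏ V ∈ 𝒦, (C 1 + ∑ a, C (κ a V) * X (Fin.castAdd h a) +
          ∑ c, C (if c ∈ V then (1 : ℂ) else 0) * X (Fin.natAdd h c))) *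
          ∏ c ∈ D, (C 1 + X (Fin.natAdd h c))) =
      2 ^ (W ∩ D).card *
        (4 * ((∑ V ∈ 𝒦, κ a V - ∑ c ∈ W, κ a {c}) * (∑ V ∈ 𝒦, κ b V - ∑ c ∈ W, κ b {c})) -
          4 * ∑ V ∈ 𝒦, κ a V * κ b V + 4 * ∑ c ∈ W, κ a {c} * κ b {c} +
          2 * (∑ V ∈ 𝒦, κ a V - ∑ c ∈ W, κ a {c}) * ∑ c ∈ W ∩ D, κ b {c} +
          2 * (∑ V ∈ 𝒦, κ b V - ∑ c ∈ W, κ b {c}) * ∑ c ∈ W ∩ D, κ a {c} +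
          (∑ c ∈ W ∩ D, κ a {c}) * (∑ c ∈ W ∩ D, κ b {c}) - ∑ c ∈ W ∩ D, κ a {c} * κ b {c}) := by
  classical
  rw [coeff_mul_prod_pureY]
  have hterm : ∀ S ∈ (W ∩ D).powerset,
      coeff (∑ a' ∈ ({a, b} : Finset (Fin h)), Finsupp.single (Fin.castAdd h a') 1 +
          ∑ c ∈ W \ S, Finsupp.single (Fin.natAdd h c) 1)
        (∏ V ∈ 𝒦, (C 1 + ∑ a, C (κ a V) * X (Fin.castAdd h a) +
          ∑ c, C (if c ∈ V then (1 : ℂ) else 0) * X (Fin.natAdd h c))) =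
      ((∑ V ∈ 𝒦, κ a V - ∑ c ∈ W, κ a {c}) * (∑ V ∈ 𝒦, κ b V - ∑ c ∈ W, κ b {c}) -
          ∑ V ∈ 𝒦, κ a V * κ b V + ∑ c ∈ W, κ a {c} * κ b {c}) +
        (∑ V ∈ 𝒦, κ a V - ∑ c ∈ W, κ a {c}) * (∑ c ∈ S, κ b {c}) +
        (∑ V ∈ 𝒦, κ b V - ∑ c ∈ W, κ b {c}) * (∑ c ∈ S, κ a {c}) +
        (∑ c ∈ S, κ a {c}) * (∑ c ∈ S, κ b {c}) - ∑ c ∈ S, κ a {c} * κ b {c} := by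
    intro S hS
    have hSW : S ⊆ W := (Finset.mem_powerset.mp hS).trans Finset.inter_subset_left
    have ea : ∑ c ∈ W \ S, κ a {c} = ∑ c ∈ W, κ a {c} - ∑ c ∈ S, κ a {c} := by
      rw [← Finset.sum_sdiff hSW]; ring
    have eb : ∑ c ∈ W \ S, κ b {c} = ∑ c ∈ W, κ b {c} - ∑ c ∈ S, κ b {c} := by
      rw [← Finset.sum_sdiff hSW]; ring
    have eab : ∑ c ∈ W \ S, κ a {c} * κ b {c} = ∑ c ∈ W, κ a {c} * κ b {c} - ∑ c ∈ S, κ a {c} * κ b {c} := by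
      rw [← Finset.sum_sdiff hSW]; ring
    rw [coeff_pair_prod_card_le_one κ 𝒦 h1 hab (W \ S) (fun c _ => hsing c), ea, eb, eab]
    ring
  rw [Finset.sum_congr rfl hterm]
  have h2a := two_mul_sum_powerset_sum (W ∩ D) (fun c => κ a {c})
  have h2b := two_mul_sum_powerset_sum (W ∩ D) (fun c => κ b {c})
  have h4 := four_mul_sum_powerset_sum_mul_sum (W ∩ D) (fun c => κ a {c}) (fun c => κ b {c})
  have hH := two_mul_sum_powerset_sum (W ∩ D) (fun c => κ a {c} * κ b {c})
  rw [Finset.sum_sub_distrib, Finset.sum_add_distrib, Finset.sum_add_distrib, Finset.sum_add_distrib,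
    Finset.sum_const, Finset.card_powerset, ← Finset.mul_sum, ← Finset.mul_sum]
  simp only [nsmul_eq_mul]
  push_cast
  linear_combination (2 * (∑ V ∈ 𝒦, κ a V - ∑ c ∈ W, κ a {c})) * h2b +
    (2 * (∑ V ∈ 𝒦, κ b V - ∑ c ∈ W, κ b {c})) * h2a + h4 - 2 * hH

end Summit.ValiantsHypothesis.ValiantsHypothesis.Theorems.BarrierLever.ChowSubcube
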